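import Summits.CriticalPhenomena.PercolationContinuityZ3.Theorems.Transplant.SkelCylinderTails
import Summits.CriticalPhenomena.PercolationContinuityZ3.Theorems.Transplant.SkelCylBall
import HarnessLib

/-!
# L4.1b + L4.2 of the general node (`HOME/SHEAR-SCOPE.md` §3.9): the FAT RADIUS, UNIFORM over the base vertices, and the FAT PRISM
# SEQUENCE `fatSeq t n = cylBall t n (ψ n)` of a planar skeleton (balls of the INDUCED cylinder graph), with the level axioms — monotone,
# margin (outer boundary ⊆ next), exhausting (from (κ) at a base vertex) — generic twin of `BoxProdZ2FibreReach` §3 + `BoxProdZ2FatPrisms`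

builds on p205010 (kernel theorem, internal audit signed; external expert review pending) — nothing in this file uses p205010.
Lane `prim-bschramm`, seat `prim-bschramm-p3` (gen 4; lead 17:59:48Z: L4.1 to p3); helper file (`--supports stmt-CriticalPhenomena-4575 --as helper`).
Design of record V83/V85 (p5-g4 §p5 item 2: fat prisms are induced-cylinder balls so that wired sources are internally connected (C1); their
fibre exits are measured in the INDUCED metric, `Skel.cylReach`).
(cylinder-ball toolkit: `SkelCylBall`; cylinder tails: `SkelCylinderTails`.)
* `exists_fatStep`, `exists_ufatStep` (one radius for all base vertices: finitely many types, antitone events), **`fatRadius hC : ℕ → ℕ`**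
  (NO centre argument: `ψ 0 = 0`, `ψ (n+1) = max (ψ n + 1) (R_{n+1} + 1)`), `fatRadius_succ_ge/_mono`, `le_fatRadius`, **`prob_cylReach_fat_le`**
  (for every `t ∈ Φ.types`: induced exits at level `n+1` from `cylBall t n (ψ n)` beyond radius `ψ(n+1) − 1` have probability `≤ 2^{-(n+1)}`;
  at a non-base centre the fat prisms are frame images of base ones with the SAME radii, `Skel.image_cylBall_of_frame`);
* **`fatSeq t n := cylBallFin t n (ψ n)`** (any centre `t`), `mem_fatSeq_iff`, `fatSeq_monotone`, **`fatSeq_nest`**, **`fatSeq_exhaust`** (`t ∈ Φ.types`),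
  `fatSeq_subset_cyl`.
[cite: KozmaNitzan2024, §4 Lemma 9 (p. 16: the scale M) — the ℤ^d model] [cite: GrimmettPercolation1999, §7.2 (7.14)–(7.16)] [cite: MartineauSevero2019, Cor. 2.2]
-/

noncomputable section

open MeasureTheory Filter ProbabilityTheory
open scoped Topology ENNReal

namespace Summit.CriticalPhenomena.PercolationContinuityZ3.Theorems

namespace Transplant

namespace Skel

open Literature.Probability.Percolation Literature.Probability.LatticeModels SimpleGraph
open Literature.Probability.Percolation.GM
open Literature.Barriers.CriticalPhenomena (graphBall graphBall_finite mem_graphBall_self graphBall_mono mem_graphBall_map)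

variable {V : Type} {G : SimpleGraph V} [G.LocallyFinite] (Φ : PlanarSkeletonConc G)

/-! ## §4 The fat radius and the fat prism sequence `fatSeq t n = cylBall t n (ψ n)` -/

/-- One step of the fat radius at ONE centre: some `R` beyond which the induced exits at level `n + 1` from `cylBall t n r` have probability
`≤ 2^{-(n+1)}`. [folklore] -/
theorem exists_fatStep [Countable V] {p : unitInterval} (hC : Φ.toPlanarSkeleton.CylSubcritical p) (t : V) (r n : ℕ) :
    ∃ R : ℕ, (bondPercolation G p).real (⋃ a ∈ cylBallFin Φ t n r, cylReach Φ t (n + 1) R a) ≤ (1 / 2 : ℝ) ^ (n + 1) :=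
  exists_prob_cylReach_biUnion_le Φ hC _
    (fun a ha => cylBall_subset_cyl Φ t (n + 1) r (cylBall_mono Φ t (Nat.le_succ n) le_rfl ((mem_cylBallFin Φ).1 ha))) (by positivity)

/-- The union of the exit events decreases in the radius. [folklore] -/
theorem biUnion_cylReach_antitone (t : V) (n : ℕ) (A : Finset V) : Antitone fun R => ⋃ a ∈ A, cylReach Φ t n R a :=
  fun _ _ h => Set.iUnion₂_mono fun a _ => cylReach_antitone Φ t n a h

/-- **One step of the fat radius, UNIFORM over the base vertices** (finitely many types; the events decrease in the radius). [folklore] -/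
theorem exists_ufatStep [Countable V] {p : unitInterval} (hC : Φ.toPlanarSkeleton.CylSubcritical p) (r n : ℕ) :
    ∃ R : ℕ, ∀ t ∈ Φ.types, (bondPercolation G p).real (⋃ a ∈ cylBallFin Φ t n r, cylReach Φ t (n + 1) R a) ≤ (1 / 2 : ℝ) ^ (n + 1) := by
  have h : ∀ t ∈ Φ.types, ∃ R : ℕ, (bondPercolation G p).real (⋃ a ∈ cylBallFin Φ t n r, cylReach Φ t (n + 1) R a) ≤ (1 / 2 : ℝ) ^ (n + 1) :=
    fun t _ => exists_fatStep Φ hC t r n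
  choose! R hR using h
  refine ⟨Φ.types.sup R, fun t ht => le_trans (measureReal_mono ?_ (measure_ne_top _ _)) (hR t ht)⟩
  exact biUnion_cylReach_antitone Φ t (n + 1) _ (Finset.le_sup ht)

/-- **The fat radius** `ψ` of the cylinder balls, uniform over the base vertices (depends on `p` through `CylSubcritical`): `ψ 0 = 0`,
`ψ (n+1) = max (ψ n + 1) (R_{n+1} + 1)` with `R_{n+1}` from `exists_ufatStep` for the sources `cylBall t n (ψ n)`, `t ∈ Φ.types`.
[cite: KozmaNitzan2024, §4 p. 16 (Lemma 9: the scale M)] -/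
def fatRadius [Countable V] {p : unitInterval} (hC : Φ.toPlanarSkeleton.CylSubcritical p) : ℕ → ℕ
  | 0 => 0
  | n + 1 => max (fatRadius hC n + 1) (Classical.choose (exists_ufatStep Φ hC (fatRadius hC n) n) + 1)

/-- The fat radius grows by at least one per level. [folklore] -/
theorem fatRadius_succ_ge [Countable V] {p : unitInterval} (hC : Φ.toPlanarSkeleton.CylSubcritical p) (n : ℕ) :
    fatRadius Φ hC n + 1 ≤ fatRadius Φ hC (n + 1) := by
  change fatRadius Φ hC n + 1 ≤ max _ _
  exact le_max_left _ _

/-- The fat radius is monotone. [folklore] -/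
theorem fatRadius_mono [Countable V] {p : unitInterval} (hC : Φ.toPlanarSkeleton.CylSubcritical p) : Monotone (fatRadius Φ hC) := by
  refine monotone_nat_of_le_succ fun n => ?_
  have := fatRadius_succ_ge Φ hC n; omega

/-- `n ≤ ψ n`. [folklore] -/
theorem le_fatRadius [Countable V] {p : unitInterval} (hC : Φ.toPlanarSkeleton.CylSubcritical p) (n : ℕ) : n ≤ fatRadius Φ hC n := by
  induction n with
  | zero => exact Nat.zero_le _
  | succ n ih => have := fatRadius_succ_ge Φ hC n; omega

/-- **The defining estimate of the fat radius** (at every base vertex): induced exits at level `n + 1` from `cylBall t n (ψ n)` beyond radius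
`ψ(n+1) − 1` have probability `≤ 2^{-(n+1)}`. [folklore] -/
theorem prob_cylReach_fat_le [Countable V] {p : unitInterval} (hC : Φ.toPlanarSkeleton.CylSubcritical p) {t : V} (ht : t ∈ Φ.types)
    (n : ℕ) :
    (bondPercolation G p).real
      (⋃ a ∈ cylBallFin Φ t n (fatRadius Φ hC n), cylReach Φ t (n + 1) (fatRadius Φ hC (n + 1) - 1) a) ≤ (1 / 2 : ℝ) ^ (n + 1) := by
  have hspec := Classical.choose_spec (exists_ufatStep Φ hC (fatRadius Φ hC n) n) t ht
  set R := Classical.choose (exists_ufatStep Φ hC (fatRadius Φ hC n) n) with hR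
  have hle : R ≤ fatRadius Φ hC (n + 1) - 1 := by
    have : R + 1 ≤ fatRadius Φ hC (n + 1) := by
      change R + 1 ≤ max _ _; exact le_max_right _ _
    omega
  refine le_trans (measureReal_mono ?_ (measure_ne_top _ _)) hspec
  exact Set.iUnion₂_mono fun a _ => cylReach_antitone Φ t (n + 1) a hle

/-- **The fat prism sequence** `Λ^fat_n(t) = cylBall t n (ψ n)` (a ball of the INDUCED cylinder graph: internally connected, frame-
and point-group-equivariant — `SkelCylBall`). [cite: KozmaNitzan2024, §4 p. 16 (Lemma 9)] -/
def fatSeq [Countable V] {p : unitInterval} (hC : Φ.toPlanarSkeleton.CylSubcritical p) (t : V) (n : ℕ) : Finset V :=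
  cylBallFin Φ t n (fatRadius Φ hC n)

/-- Membership in the fat prism. [folklore] -/
theorem mem_fatSeq_iff [Countable V] {p : unitInterval} (hC : Φ.toPlanarSkeleton.CylSubcritical p) {t : V} {n : ℕ} {v : V} :
    v ∈ fatSeq Φ hC t n ↔ v ∈ Φ.cylBall t n (fatRadius Φ hC n) :=
  mem_cylBallFin Φ

/-- The fat prisms increase. [folklore] -/
theorem fatSeq_monotone [Countable V] {p : unitInterval} (hC : Φ.toPlanarSkeleton.CylSubcritical p) (t : V) : Monotone (fatSeq Φ hC t) := by
  intro n n' h v hv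
  rw [mem_fatSeq_iff] at hv ⊢
  exact cylBall_mono Φ t h (fatRadius_mono Φ hC h) hv

/-- **Margin**: the outer boundary of a fat prism lies in the next one (a neighbour of `cylBall t n (ψ n)` has skeleton coordinate in
`Λ_{n+1}` by `lip`, and induced distance `≤ ψ n + 1 ≤ ψ (n+1)` in the larger cylinder). [folklore] -/
theorem fatSeq_nest [DecidableEq V] [Countable V] {p : unitInterval} (hC : Φ.toPlanarSkeleton.CylSubcritical p) (t : V) (n : ℕ) :
    outerBoundary G (fatSeq Φ hC t n) ⊆ fatSeq Φ hC t (n + 1) := by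
  intro v hv
  rw [outerBoundary, Finset.mem_sdiff, Finset.mem_biUnion] at hv
  obtain ⟨⟨w, hw, hvw⟩, -⟩ := hv
  rw [SimpleGraph.mem_neighborFinset] at hvw
  rw [mem_fatSeq_iff] at hw ⊢
  -- `v` lies in the cylinder of half-width `n + 1`
  have hvc : v ∈ Φ.toPlanarSkeleton.cyl t (n + 1) := by
    have hwc := cylBall_subset_cyl Φ t n _ hw
    rw [PlanarSkeleton.mem_cyl, mem_box] at hwc ⊢
    intro i
    have h1 := hwc i
    have h2 := Φ.lip hvw i
    simp only [Pi.sub_apply] at h1 ⊢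
    rw [abs_le] at h2
    constructor <;> push_cast <;> linarith [h1.1, h1.2, h2.1, h2.2]
  exact cylBall_mono Φ t le_rfl (fatRadius_succ_ge Φ hC n) (mem_cylBall_succ_of_adj Φ t (Nat.le_succ n) hw hvw hvc)

/-- **Exhaustion**: every vertex lies in some fat prism about a BASE vertex `t` (uses (κ): the induced cylinders at `t` of half-width
`≥ 1` are connected). [folklore] -/
theorem fatSeq_exhaust [Countable V] {p : unitInterval} (hC : Φ.toPlanarSkeleton.CylSubcritical p) {t : V} (ht : t ∈ Φ.types) (v : V) :
    ∃ n, v ∈ fatSeq Φ hC t n := by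
  -- a cylinder of half-width `m ≥ 1` containing `v`
  set m : ℕ := (Φ.φ v 0 - Φ.φ t 0).natAbs + (Φ.φ v 1 - Φ.φ t 1).natAbs + 1 with hm
  have hvm : v ∈ Φ.toPlanarSkeleton.cyl t m := by
    rw [PlanarSkeleton.mem_cyl, mem_box]
    intro i
    simp only [Pi.sub_apply]
    have ha0 := le_abs_self (Φ.φ v 0 - Φ.φ t 0); have ha0' := neg_abs_le (Φ.φ v 0 - Φ.φ t 0)
    have ha1 := le_abs_self (Φ.φ v 1 - Φ.φ t 1); have ha1' := neg_abs_le (Φ.φ v 1 - Φ.φ t 1)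
    have hb0 := abs_nonneg (Φ.φ v 0 - Φ.φ t 0); have hb1 := abs_nonneg (Φ.φ v 1 - Φ.φ t 1)
    fin_cases i <;> constructor <;> simp only [hm] <;> push_cast <;> linarith
  -- a walk in the induced cylinder, by (κ)
  have hconn := Φ.cyl_connected t ht m (by omega)
  obtain ⟨wk⟩ := hconn.preconnected ⟨t, Φ.toPlanarSkeleton.mem_cyl_self t m⟩ ⟨v, hvm⟩
  refine ⟨max m wk.length, (mem_fatSeq_iff Φ hC).2 ?_⟩
  refine cylBall_mono Φ t (le_max_left _ _) ((le_max_right _ _).trans (le_fatRadius Φ hC _)) ?_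
  exact ⟨⟨v, hvm⟩, ⟨wk, le_rfl⟩, rfl⟩

/-- Fat prisms lie in their cylinder. [folklore] -/
theorem fatSeq_subset_cyl [Countable V] {p : unitInterval} (hC : Φ.toPlanarSkeleton.CylSubcritical p) (t : V) (n : ℕ) :
    (↑(fatSeq Φ hC t n) : Set V) ⊆ Φ.toPlanarSkeleton.cyl t n := fun _ hv =>
  cylBall_subset_cyl Φ t n _ ((mem_fatSeq_iff Φ hC).1 (Finset.mem_coe.1 hv))

end Skel

end Transplant

end Summit.CriticalPhenomena.PercolationContinuityZ3.Theorems

end
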